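import Summits.QuantumFields.BalabanUV.T4Continuum.Support.ShellMeasureLevelZeroBoxWitness

/-!
# `T4Continuum.ShellMeasureLevelZeroLedgerWitness` — rule G-1 at level 0, END-I side: THE ONE-RUN LEVEL-0 LEDGER OF THE `SU(2)`
# GIBBS MEASURE (S19 §2) FIRES ON CONCRETE DATA WITH NO BINDER LEFT
(cell `pub-balaban`, sub-cell `t4`, spine estimate NE7c (node U5b); NE7c ROUND-2 crew, unit
`b2b-balaban-t4-ne7c-formalise-leaf-10` gen 11; row S89 f4 (S89 = rule G-1 retro-fit at level 0: f1 `ShellMeasureLevelZeroBoxWitness`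
p229619 — the faces S11 ∕ S19 §1 ∕ S44; f2 `ShellMeasureLevelZeroShellMass` — positive shell mass; f3 `ShellMeasureLevelZeroWindowWitness`
— the window faces); this f4 instantiates leaf-06's S19 §2 `ShellMeasureWilsonLedger.levelLedger_wilson_su2_levelZero` — END-I's
one-run level-0 LEDGER of the full Gibbs law — on S89 f1's concrete data; ADDITIVE — imports S89 f1 ONLY; [folklore]; 0 `def`,
0 `def … : Prop`, 0 sorry, 0 citation tags)

HONEST FRAMING.  Finite four-torus programme, rung (B)+1 only — NOT infinite volume, NOT a mass gap, NOT the Clay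
problem, NOT summit progress; (B), `BetaPertHyp`, (B^μ) not consumed.  NE7c (`T4IndicatorShell.ShellWeightBound`) is NOT
PRINTED in [Balaban 1983–89] and NOT PROVED; «NE7c ⇐ the named binders».  The level-0 ledger serves comparisons `K ≤ N₁` only;
it is ONE run's (R)+[dict]+(M1)₀ bookkeeping, NOT the two-run `ShellWeightBound` (which also needs the LIVE levels, (W1), the rate).
A CONSISTENCY CERTIFICATE of OUR level-0 wiring; nothing of Bałaban's.  HONEST DEPENDENCY (cell): continuum YM on T⁴ ⇐ BetaPertH ∧
nine spine estimates (0/9 proved); BetaPertH ⇐ (D1) ∧ (D4) ∧ CAP+tail; G-an2-4 gates asym, D1 and NE2/3/4.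

THE POINT.  S19 §2 takes ≈ 35 binders: the per-slot box geometry (f1's family, per slot `s : σ₀`), the exterior ∕ weight split of
the action's plaquette set `P_all`, the numerics, a uniform constant `D 0`, the cubes `C K` present at each cutoff, and the U1b-type
a.e. CLOSENESS `|wilsonU − u^B K t s| ≤ ρ₀θ₀` of the other run's tested variable.  ALL of them are inhabited at once by: ONE slot
type `σ₀ := Unit` with f1's concrete data (torus `toyParams`, corner `0`, side-2 box, `Λ := blockBonds`, `P_u := boxPlaqF`,
`P_ext ∕ P_w :=` f1's split of ANY `P_all`), the numbers `S = 10⁻⁴`, `σ = θ₀ = 2·10⁻⁵`, `δ = ½`, `ρ ≡ ¼`, `D ≡` the slot constant, ANY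
cube schedule `C : ℕ → Finset Unit`, ANY `l₀`, and the other run's variable `u^B := wilsonU` ITSELF (closeness `0 ≤ ρ₀θ₀` — the
trivial inhabitant; the REAL closeness is node U1b's, by name).  Conclusion: `T4ShellMeasureLevels.LevelLedger …` LITERALLY, by ONE
call (`levelZero_ledger_su2_inhabited`).  NOTHING in the countdown moves; NE7c NOT PROVED; spine 0∕9.
-/

noncomputable section

open Set Function MeasureTheory

namespace Summit.QuantumFields.BalabanUV.T4Continuum.ShellMeasureLevelZeroLedgerWitness

open scoped ENNReal Matrix.Norms.L2Operator
open Literature.MathematicalPhysics.QuantumFieldTheory.Balaban1983to89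
open T4ShellMeasureLevels (LevelLedger)
open T4CubeChartGnomonic (SU2)
open T4AxialGaugeSmallField (boxPlaqs boxBonds)
open ShellMeasureWilsonRealizedSU2 (wilsonU measurable_wilsonU)
open ShellMeasureRootCompositionPushCubes (regionWeight regionShell regionPiece)
open ShellMeasureWilsonLedger (levelLedger_wilson_su2_levelZero)
open ShellMeasureSmallnessArithmetic (sm0_of_window)
open ShellMeasureLevelZeroBoxWitness

/-- **END-I's ONE-RUN LEVEL-0 LEDGER OF THE `SU(2)` GIBBS MEASURE FIRES WITH NO BINDER LEFT** (S19 §2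
`levelLedger_wilson_su2_levelZero` at S89 f1's concrete data): torus `toyParams` (`d = 2`, six sites per direction), level `0`, ONE
slot type `Unit` carrying the corner-`0` side-2 box with `Λ := blockBonds`, `P_u := boxPlaqF`, the split `exteriorPlaqs ∕ weightPlaqs`
of an ARBITRARY finite plaquette set `P_all` (the action), `S = 10⁻⁴`, `σ = θ₀ = 2·10⁻⁵`, `δ = ½`, `ρ ≡ ¼`, `D ≡ 2(#(Λ × Fin 3) +
β·Σ_{P_w} 8S(8 + 32S))∕(1 − ½)`, ANY cube schedule `C`, ANY `l₀`, the other run's tested variable `:= wilsonU` itself (closeness `0`):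
the `LevelLedger` of row S17's region families against the Gibbs law `e^{−β Σ_{P_all}(1 − Re tr U(∂p))} dU`. [folklore] -/
theorem levelZero_ledger_su2_inhabited [DecidableEq (PBond toyParams 0)] [DecidableEq (Plaq toyParams 0)] {β : ℝ}
    (hβ : 0 ≤ β) (Pall : Finset (Plaq toyParams 0)) (C : ℕ → Finset Unit) (l₀ : ℝ) :
    ∃ hPu : (boxPlaqF (P := toyParams) (j := 0) 0 (fun κ => (0 : Fin toyParams.d → ℤ) κ + 2)).Nonempty,
      LevelLedger l₀ (fun K => (C K).powerset)
        (fun K (_ : ℝ) => regionWeight (C K)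
          ((fieldMeasure toyParams 0 SU2).withDensity fun U =>
            ENNReal.ofReal (Real.exp (-(β * ∑ p ∈ Pall, (1 - reTr (GaugeField.plaqHol U p))))))
          (fun _ : Unit => wilsonU hPu) (2 / 10 ^ 5))
        (fun K (_ : ℝ) => regionShell (C K)
          ((fieldMeasure toyParams 0 SU2).withDensity fun U =>
            ENNReal.ofReal (Real.exp (-(β * ∑ p ∈ Pall, (1 - reTr (GaugeField.plaqHol U p))))))
          (fun _ : Unit => wilsonU hPu) (fun _ : Unit => wilsonU hPu) (2 / 10 ^ 5))
        C
        (fun K (_ : ℝ) => regionPiece (C K)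
          ((fieldMeasure toyParams 0 SU2).withDensity fun U =>
            ENNReal.ofReal (Real.exp (-(β * ∑ p ∈ Pall, (1 - reTr (GaugeField.plaqHol U p))))))
          (fun _ : Unit => wilsonU hPu) (fun _ : Unit => wilsonU hPu) (2 / 10 ^ 5))
        (fun _ _ => 0)
        (fun _ => 2 * (((Fintype.card (↥(blockBonds (P := toyParams) (j := 0) 0
            (fun κ => (0 : Fin toyParams.d → ℤ) κ + 2)) × Fin 3) : ℕ) : ℝ) +
          β * ∑ _p ∈ weightPlaqs (blockBonds (P := toyParams) (j := 0) 0 (fun κ => (0 : Fin toyParams.d → ℤ) κ + 2)) Pall,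
            (8 * (1 / 10 ^ 4 : ℝ)) * (8 + 4 * (8 * (1 / 10 ^ 4 : ℝ)))) / (1 - 1 / 2))
        (fun _ => 1 / 4) := by
  have hd : 2 ≤ toyParams.d := le_rfl
  have h3 : 3 ≤ toyParams.sitesPerDir 0 := by rw [toyParams_sitesPerDir]; norm_num
  have h01 := dir_zero_lt_one hd
  have hsq := side_two_square (P := toyParams) (0 : Fin toyParams.d → ℤ) _ _ h01
  have hN := side_two_nonwrapping (j := 0) h3 (0 : Fin toyParams.d → ℤ)
  have hPu := boxPlaqF_nonempty (P := toyParams) (j := 0) h01 hsq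
  refine ⟨hPu, ?_⟩
  have hπ4 := Real.pi_le_four
  have hπ3 := Real.pi_gt_three
  have hrad : ((toyParams.d - 1 : ℕ) : ℝ) * (2 : ℕ) * (2 / 10 ^ 5 : ℝ) ≤ 2 * (1 / 10 ^ 4) / Real.pi := by
    rw [le_div_iff₀ Real.pi_pos]
    simp only [toyParams, Nat.cast_ofNat]
    norm_num
    nlinarith
  have hSM : 4 * (8 * (1 / 10 ^ 4 : ℝ)) ^ 2 * Real.exp (2 * (8 * (1 / 10 ^ 4 : ℝ))) ≤ 1 / 2 * (2 / 10 ^ 5) :=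
    sm0_of_window (by norm_num) (by norm_num)
  exact levelLedger_wilson_su2_levelZero (P := toyParams) (j := 0) (σ₀ := Unit)
    (fun _ => (0 : Fin toyParams.d → ℤ)) (fun _ => fun κ => (0 : Fin toyParams.d → ℤ) κ + 2) (fun _ => 2)
    (fun _ => hN) (fun _ => side_two_side (P := toyParams) 0)
    (fun _ => blockBonds 0 _) (fun _ => blockBonds_box 0 _) (fun _ => disjoint_blockBonds_comb 0 _) (fun _ => cover_blockBonds 0 _)
    (fun _ => Fintype.card (↥(blockBonds (P := toyParams) (j := 0) 0 (fun κ => (0 : Fin toyParams.d → ℤ) κ + 2)) × Fin 3))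
    (fun _ => Fintype.equivFin _)
    (S := 1 / 10 ^ 4) (σ := 2 / 10 ^ 5) (by norm_num) (by norm_num) (by nlinarith) (by norm_num) (fun _ => hrad)
    (fun _ => boxPlaqF 0 _) (fun _ => hPu) (fun _ => boxPlaqF_box 0 _) (fun _ => boxPlaqs_subset_boxPlaqF 0 _)
    (fun _ => weightPlaqs (blockBonds 0 _) Pall) (fun _ => exteriorPlaqs (blockBonds 0 _) Pall) Pall
    (θ := fun _ => 2 / 10 ^ 5) (ρ := fun _ => 1 / 4)
    (D := fun _ => 2 * (((Fintype.card (↥(blockBonds (P := toyParams) (j := 0) 0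
        (fun κ => (0 : Fin toyParams.d → ℤ) κ + 2)) × Fin 3) : ℕ) : ℝ) +
          β * ∑ _p ∈ weightPlaqs (blockBonds (P := toyParams) (j := 0) 0 (fun κ => (0 : Fin toyParams.d → ℤ) κ + 2)) Pall,
            (8 * (1 / 10 ^ 4 : ℝ)) * (8 + 4 * (8 * (1 / 10 ^ 4 : ℝ)))) / (1 - 1 / 2))
    hβ (by norm_num) le_rfl (by norm_num) (by norm_num) (fun _ => by norm_num) (by norm_num) hSM hSM
    (fun _ => exteriorPlaqs_spec _ _) (fun _ => disjoint_exterior_weight _ _) (fun _ => exterior_union_weight _ _)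
    (fun _ => by positivity) (fun _ => le_rfl) C (l₀ := l₀) (fun _ _ _ => wilsonU hPu) (fun _ _ _ => measurable_wilsonU hPu)
    (fun K t _ s _ => Filter.Eventually.of_forall fun U => by simp; positivity)

end Summit.QuantumFields.BalabanUV.T4Continuum.ShellMeasureLevelZeroLedgerWitness

end
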